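import Summits.Ventures.PercRepro.CoreSevenPlanes
import Summits.Ventures.PercRepro.CoreSixNine

/-!
# PercRepro — the corank-`7` core cell `p = 9` (p2, gen 12)

`n = |E| = 16`, nullity `7`. The sets of rank `≤ 3` with `≥ 5` points are bounded by BOTH `29·s₄/7` (`CorePlanes`) and
`s₄ + 396` (`CoreSevenPlanes`); with `A := min` of the two the method of `CoreSixNine` closes the cell: `ν(S₀) ≤ 6`
(`s₃ ≤ 36`, `s₄ ≤ 312` by night-1's count at nullity `≤ 6`): ratio `0.93`; `S₀ = E` (series classes, the count with the
exact number of classes at nullity `7`): 64 class-size vectors by kernel evaluation, worst `0.96` (all classes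
singletons: `s₃ ≤ 49`, `s₄ ≤ 286`).

* `cellOK7`, `cellOK7_spec`, **`rls_of_cellOK7`**; **`c025_core_seven_nine`**;
* `SmallCoreCellsNine`, `smallCoreCellsEight_of_nine`, **`c025_three_of_smallCoreCellsNine`** — the `q = 3` row from
  the cells `p ∈ {7, 8}` and the corank-`4`/`5` cells covered by night-1's staged files only.
Imports `CoreSevenPlanes`, `CoreSixNine`. Axioms: standard.
-/

namespace PercRepro
namespace CoreFour

open Finset Set

variable {α : Type} {M : Matroid α}

/-- The corank-`7` cell with `A := min (29·s₄/7) (s₄ + 396)`. -/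
def cellOK7 (n s₃ s₄ : ℕ) : Bool :=
  let p := n - 7
  let phiNum := 2 ^ (p + 3) - 2 * ∑ u ∈ range 4, CoreRegimes.chooseF (p + 3) u
  let phiDen := CoreRegimes.chooseF (p + 3) 3
  let A := min (29 * s₄ / 7) (s₄ + 396)
  let U := CoreRegimes.chooseF n 3 + (s₃ * (n - 3) + s₄) + A
  let R := (∑ j ∈ range 4, CoreRegimes.chooseF n j) + (s₃ * (n - 3) + s₄) + A
  let S := ∑ j ∈ range 8, CoreRegimes.chooseF n j
  decide (phiNum * U + phiDen * (R + S) ≤ phiDen * 2 ^ n)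

/-- What `cellOK7 n s₃ s₄ = true` says, as an inequality in `ℕ` (with `A = min (29·s₄/7) (s₄ + 396)`). -/
theorem cellOK7_spec {n s₃ s₄ : ℕ} (h : cellOK7 n s₃ s₄ = true) :
    (2 ^ (n - 7 + 3) - 2 * ∑ u ∈ range 4, Nat.choose (n - 7 + 3) u) *
        (n.choose 3 + (s₃ * (n - 3) + s₄) + min (29 * s₄ / 7) (s₄ + 396)) +
      Nat.choose (n - 7 + 3) 3 * (((∑ j ∈ range 4, n.choose j) + (s₃ * (n - 3) + s₄) + min (29 * s₄ / 7) (s₄ + 396)) +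
        ∑ j ∈ range 8, n.choose j) ≤ Nat.choose (n - 7 + 3) 3 * 2 ^ n := by
  unfold cellOK7 at h
  simp only [CoreRegimes.chooseF_eq] at h
  exact of_decide_eq_true h

/-- **A kernel-evaluated cell gives C-025 at `(9, 3)`** on the coloop-free core with (C1), (C2), `|E| = 16`. -/
theorem rls_of_cellOK7 (M : Matroid α) [M.Finite] (p : ℕ) (hp : p = 9)
    (hs : ∀ e ∈ M.E, ∀ f ∈ M.E, e ≠ f → M.eRk {e, f} = 2)
    (hC1 : ∀ L ⊆ M.E, M.eRk L = 2 → L.ncard ≤ 3) (hC2 : ∀ P ⊆ M.E, M.eRk P = 3 → P.ncard ≤ 7)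
    (hcoloop : ∀ e, ¬ M.IsColoop e) (hrank : M.eRank = (p : ℕ∞)) (hE : M.E.ncard = p + 7)
    {s₃ s₄ : ℕ} (hs₃ : (PercRepro.Matroid.circuitsEq M 3).ncard ≤ s₃)
    (hs₄ : (PercRepro.Matroid.circuitsEq M 4).ncard ≤ s₄)
    (hcell : cellOK7 (p + 7) s₃ s₄ = true) : ThmN.RLS M p 3 := by
  classical
  have hEcard : M.ground_finite.toFinset.card = p + 7 := by
    rw [← hE, Set.ncard_eq_toFinset_card _ M.ground_finite]
  have hd : M.E.encard = M.eRank + 7 := by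
    rw [hrank, ← M.ground_finite.cast_ncard_eq, hE]; push_cast; rfl
  have hrank9 : M.eRank = ((9 : ℕ) : ℕ∞) := by rw [hrank, hp]
  have hE16 : M.E.ncard = 16 := by omega
  have hrank2 : 2 ≤ M.eRank := by rw [hrank]; exact_mod_cast (show 2 ≤ p by omega)
  have h4 : {X : Set α | X ⊆ M.E ∧ X.ncard = 4 ∧ M.eRk X ≤ 3}.ncard ≤ s₃ * (p + 7 - 3) + s₄ := by
    have h := ncard_four_sets_le hs hrank2
    rw [hE] at h
    have h' : (PercRepro.Matroid.circuitsEq M 3).ncard * (p + 7 - 3) ≤ s₃ * (p + 7 - 3) :=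
      Nat.mul_le_mul_right _ hs₃
    omega
  have hbig : {X : Set α | X ⊆ M.E ∧ M.eRk X ≤ 3 ∧ 5 ≤ X.ncard}.ncard ≤ min (29 * s₄ / 7) (s₄ + 396) := by
    have h1 := seven_mul_ncard_big_sets_le hs hC1 hC2
    have h2 := seven_mul_ncard_big_sets_le_seven hs hC1 hC2 hcoloop hd hrank9 hE16
    have h1' : 29 * (PercRepro.Matroid.circuitsEq M 4).ncard ≤ 29 * s₄ := Nat.mul_le_mul_left _ hs₄
    have h2' : 7 * (PercRepro.Matroid.circuitsEq M 4).ncard ≤ 7 * s₄ := Nat.mul_le_mul_left _ hs₄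
    apply le_min
    · rw [Nat.le_div_iff_mul_le (by norm_num)]; omega
    · omega
  have hU : Matroid.topCount M p 3 ≤ (p + 7).choose 3 + (s₃ * (p + 7 - 3) + s₄) + min (29 * s₄ / 7) (s₄ + 396) := by
    have h := topCount_le_general (M := M) p
    rw [hE] at h
    omega
  have hR : {X : Set α | X ⊆ M.E ∧ M.eRk X ≤ 3}.ncard ≤
      (∑ j ∈ range 4, (p + 7).choose j) + (s₃ * (p + 7 - 3) + s₄) + min (29 * s₄ / 7) (s₄ + 396) := by
    have h := ncard_eRk_le_three_le_general (M := M)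
    rw [hE] at h
    omega
  have hS : {X : Set α | X ⊆ M.E ∧ M.eRk X = M.eRank}.ncard ≤ ∑ j ∈ range 8, (p + 7).choose j := by
    have h := PercRepro.Matroid.ncard_spanning_le (M := M) (d := 7) hd
    rw [hEcard] at h
    exact h
  have hY : 2 ^ (p + 7) ≤ Matroid.midCount M p 3 + {X : Set α | X ⊆ M.E ∧ M.eRk X ≤ 3}.ncard +
      {X : Set α | X ⊆ M.E ∧ M.eRk X = M.eRank}.ncard := by
    have h := PercRepro.Matroid.two_pow_le_midCount_add (M := M) p 3 hrank
    rw [hEcard] at h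
    exact h
  have hcell' := cellOK7_spec hcell
  rw [Nat.add_sub_cancel] at hcell'
  obtain ⟨phiNum, hphiNum⟩ : ∃ x, x = 2 ^ (p + 3) - 2 * ∑ u ∈ range 4, Nat.choose (p + 3) u := ⟨_, rfl⟩
  obtain ⟨phiDen, hphiDen⟩ : ∃ x, x = Nat.choose (p + 3) 3 := ⟨_, rfl⟩
  obtain ⟨U, hU_def⟩ : ∃ x, x = (p + 7).choose 3 + (s₃ * (p + 7 - 3) + s₄) + min (29 * s₄ / 7) (s₄ + 396) :=
    ⟨_, rfl⟩
  obtain ⟨R, hR_def⟩ : ∃ x, x = (∑ j ∈ range 4, (p + 7).choose j) + (s₃ * (p + 7 - 3) + s₄) +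
      min (29 * s₄ / 7) (s₄ + 396) := ⟨_, rfl⟩
  obtain ⟨S, hS_def⟩ : ∃ x, x = ∑ j ∈ range 8, (p + 7).choose j := ⟨_, rfl⟩
  rw [← hphiNum, ← hphiDen, ← hU_def, ← hR_def, ← hS_def] at hcell'
  rw [← hU_def] at hU
  rw [← hR_def] at hR
  rw [← hS_def] at hS
  have hUq : (Matroid.topCount M p 3 : ℚ) ≤ (U : ℚ) := by exact_mod_cast hU
  have hRq : ({X : Set α | X ⊆ M.E ∧ M.eRk X ≤ 3}.ncard : ℚ) ≤ (R : ℚ) := by exact_mod_cast hR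
  have hSq : ({X : Set α | X ⊆ M.E ∧ M.eRk X = M.eRank}.ncard : ℚ) ≤ (S : ℚ) := by exact_mod_cast hS
  have hYq : ((2 : ℕ) ^ (p + 7) : ℚ) ≤ (Matroid.midCount M p 3 : ℚ) +
      ({X : Set α | X ⊆ M.E ∧ M.eRk X ≤ 3}.ncard : ℚ) +
      ({X : Set α | X ⊆ M.E ∧ M.eRk X = M.eRank}.ncard : ℚ) := by exact_mod_cast hY
  have hcellq : (phiNum : ℚ) * (U : ℚ) + (phiDen : ℚ) * ((R : ℚ) + (S : ℚ)) ≤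
      (phiDen : ℚ) * ((2 : ℕ) ^ (p + 7) : ℚ) := by exact_mod_cast hcell'
  have hsub : 2 * ∑ u ∈ range 4, Nat.choose (p + 3) u ≤ 2 ^ (p + 3) := by
    have := CoreRegimes.sum_Ioo_choose_add p (by omega); omega
  have hphi : phiK p 3 * (phiDen : ℚ) = (phiNum : ℚ) := by
    rw [hphiNum, Nat.cast_sub hsub, hphiDen]
    push_cast
    exact CoreRegimes.phiK_three_mul_choose_eq p (by omega)
  have hDpos : (0 : ℚ) < (phiDen : ℚ) := by
    rw [hphiDen]; exact_mod_cast Nat.choose_pos (by omega)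
  have hNnn : (0 : ℚ) ≤ (phiNum : ℚ) := by positivity
  have h1 : (phiNum : ℚ) * (Matroid.topCount M p 3 : ℚ) ≤ (phiNum : ℚ) * (U : ℚ) :=
    mul_le_mul_of_nonneg_left hUq hNnn
  have h2 : (phiDen : ℚ) * ((2 : ℕ) ^ (p + 7) : ℚ) ≤
      (phiDen : ℚ) * ((Matroid.midCount M p 3 : ℚ) + (R : ℚ) + (S : ℚ)) :=
    mul_le_mul_of_nonneg_left (by linarith) hDpos.le
  have hkey : (phiNum : ℚ) * (Matroid.topCount M p 3 : ℚ) ≤ (phiDen : ℚ) * (Matroid.midCount M p 3 : ℚ) := by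
    have h2' := h2
    rw [mul_add, mul_add] at h2'
    have hc' := hcellq
    rw [mul_add] at hc'
    have hUmid : (phiNum : ℚ) * (U : ℚ) ≤ (phiDen : ℚ) * (Matroid.midCount M p 3 : ℚ) := by linarith
    linarith
  rw [ThmN.RLS_iff]
  rw [← hphi] at hkey
  have : phiK p 3 * (Matroid.topCount M p 3 : ℚ) * (phiDen : ℚ) ≤ (Matroid.midCount M p 3 : ℚ) * (phiDen : ℚ) := by
    calc phiK p 3 * (Matroid.topCount M p 3 : ℚ) * (phiDen : ℚ)
        = phiK p 3 * (phiDen : ℚ) * (Matroid.topCount M p 3 : ℚ) := by ring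
      _ ≤ (phiDen : ℚ) * (Matroid.midCount M p 3 : ℚ) := hkey
      _ = (Matroid.midCount M p 3 : ℚ) * (phiDen : ℚ) := by ring
  exact le_of_mul_le_mul_right this hDpos

/-- The cell `n = 16` with `s₃ = 36`, `s₄ = 312`. -/
theorem table_sparse7 : cellOK7 (9 + 7) 36 312 = true := by
  decide +kernel

/-- The cocircuit count at nullity `7`: `#{k-circuits} ≤ C(c, 6) / C(c − k − 6 + 2, 2)`. -/
def lm7 (c k : ℕ) : ℕ := c.choose 6 / (c - k - 6 + 2).choose 2

/-- The count `s · C(c − k − 4, 2) ≤ C(c, 6)` read as the bound `s ≤ lm7 c k`. -/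
theorem le_lm7_of_mul_le {s c k : ℕ} (h : s * (c - k - 6 + 2).choose 2 ≤ c.choose 6) : s ≤ lm7 c k := by
  unfold lm7
  rw [Nat.le_div_iff_mul_le (Nat.choose_pos (by omega))]
  exact h

/-- The dense-case bound on `s₃` at corank `7`: `min 49 (min (lm7 c 3) (C(σ,3) + σ t₂ + t₃))`, `c = σ + t₂ + t₃ + t₄`. -/
def bound3seven (σ t₂ t₃ t₄ : ℕ) : ℕ :=
  min 49 (min (lm7 (σ + t₂ + t₃ + t₄) 3) (σ.choose 3 + σ * t₂ + t₃))

/-- The dense-case bound on `s₄` at corank `7`: `min (lm7 c 4) (C(σ,4) + C(σ,2) t₂ + C(t₂,2) + σ t₃ + t₄)`. -/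
def bound4seven (σ t₂ t₃ t₄ : ℕ) : ℕ :=
  min (lm7 (σ + t₂ + t₃ + t₄) 4) (σ.choose 4 + σ.choose 2 * t₂ + t₂.choose 2 + σ * t₃ + t₄)

/-- Every class-size vector of the all-dense case at `n = 16`. -/
theorem table_dense7_16 : ∀ σ < 17, ∀ t₂ < 9, ∀ t₃ < 6, ∀ t₄ < 5, σ + 2 * t₂ + 3 * t₃ + 4 * t₄ = 16 →
    cellOK7 (9 + 7) (bound3seven σ t₂ t₃ t₄) (bound4seven σ t₂ t₃ t₄) = true := by
  decide +kernel

/-- **C-025 at `(9, 3)` on the coloop-free core at corank `7`.** -/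
theorem c025_core_seven_nine (M : Matroid α) [M.Finite]
    (hs : ∀ e ∈ M.E, ∀ f ∈ M.E, e ≠ f → M.eRk {e, f} = 2) (hcoloop : ∀ e, ¬ M.IsColoop e)
    (hfree : ∀ e ∈ M.E, ∃ A ⊆ M.E \ {e}, e ∉ M.closure A ∧ e ∉ M.closure ((M.E \ {e}) \ A))
    (hrank : M.eRank = ((9 : ℕ) : ℕ∞)) (hE : M.E.ncard = 9 + 7) : ThmN.RLS M 9 3 := by
  classical
  have hC1 : ∀ L ⊆ M.E, M.eRk L = 2 → L.ncard ≤ 3 :=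
    fun L hL hr => ThmN.ncard_le_three_of_eRk_two M hs hfree hL hr
  have hC2 : ∀ P ⊆ M.E, M.eRk P = 3 → P.ncard ≤ 7 :=
    fun P hP hr => ThmN.ncard_le_seven_of_eRk_three M hs hfree hP hr
  have hd : M.E.encard = M.eRank + 7 := by
    rw [hrank, ← M.ground_finite.cast_ncard_eq, hE]; push_cast; rfl
  set S₀ := ⋃₀ PercRepro.Matroid.circuitsLE M 4 with hS₀def
  have hS₀E : S₀ ⊆ M.E := sUnion_circuitsLE_subset_ground M 4
  have hS₀fin : S₀.Finite := M.ground_finite.subset hS₀E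
  obtain ⟨r, hr⟩ := exists_eRk_eq_nat (M := M) S₀
  have hrle : r ≤ S₀.ncard := by
    have := M.eRk_le_encard S₀
    rw [hr, ← hS₀fin.cast_ncard_eq] at this
    exact_mod_cast this
  have hd' : S₀.encard = M.eRk S₀ + ((S₀.ncard - r : ℕ) : ℕ∞) := by
    rw [hr, ← hS₀fin.cast_ncard_eq]
    have : S₀.ncard = r + (S₀.ncard - r) := by omega
    conv_lhs => rw [this]
    push_cast; rfl
  have hmono := encard_le_eRk_add_of_ground hS₀E hd
  rw [hd'] at hmono
  have hle7 : S₀.ncard - r ≤ 7 := by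
    have h := (WithTop.add_le_add_iff_left (by rw [hr]; exact WithTop.natCast_ne_top r)).1 hmono
    have h' : ((S₀.ncard - r : ℕ) : ℕ∞) ≤ ((7 : ℕ) : ℕ∞) := h
    exact_mod_cast h'
  rcases Nat.lt_or_ge (S₀.ncard - r) 7 with hlt | hge
  · -- case A: `ν(S₀) ≤ 6`
    have hS24 : S₀.ncard ≤ 24 := by
      have := Set.ncard_le_ncard hS₀E M.ground_finite; omega
    have hs₃ : (PercRepro.Matroid.circuitsEq M 3).ncard ≤ 36 := by
      have h := ThmN.core_ncard_triangles_subset_le_sq M hs hfree hS₀E hd'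
      have hsub : PercRepro.Matroid.circuitsEq M 3 ⊆
          {C : Set α | M.IsCircuit C ∧ C.ncard = 3 ∧ C ⊆ S₀} := by
        intro C hC
        exact ⟨hC.1, hC.2, Set.subset_sUnion_of_mem (PercRepro.Matroid.circuitsEq_subset_circuitsLE (by norm_num) hC)⟩
      have hfin : {C : Set α | M.IsCircuit C ∧ C.ncard = 3 ∧ C ⊆ S₀}.Finite :=
        M.ground_finite.finite_subsets.subset (fun C hC => hC.1.subset_ground)
      calc (PercRepro.Matroid.circuitsEq M 3).ncard ≤ _ := Set.ncard_le_ncard hsub hfin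
        _ ≤ (S₀.ncard - r) * (S₀.ncard - r) := h
        _ ≤ 6 * 6 := Nat.mul_le_mul (show S₀.ncard - r ≤ 6 by omega) (show S₀.ncard - r ≤ 6 by omega)
        _ = 36 := by norm_num
    have hs₄ : (PercRepro.Matroid.circuitsEq M 4).ncard ≤ 312 :=
      PercRepro.Matroid.ncard_isCircuit_four_le_of_subset_nullity_le_six M hS₀E
        (fun C hC h4 => subset_sUnion_of_mem_circuitsEq_four ⟨hC, h4⟩) hS24
        (by rw [hd']; gcongr; exact_mod_cast (show S₀.ncard - r ≤ 6 by omega))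
    exact rls_of_cellOK7 M 9 rfl hs hC1 hC2 hcoloop hrank hE hs₃ hs₄ table_sparse7
  · -- case B
    have h7 : S₀.ncard - r = 7 := by omega
    rw [h7] at hd'
    have hS₀ : S₀ = M.E := eq_ground_of_encard_eq_eRk_add hcoloop hS₀E hd hd'
    have hν : M✶.eRank = 7 := by
      have h := Matroid.eRank_add_eRank_dual M
      rw [hd, hrank] at h
      exact WithTop.add_left_cancel (WithTop.natCast_ne_top 9) h
    have hs49 : (PercRepro.Matroid.circuitsEq M 3).ncard ≤ 49 := by
      have h := ThmN.ncard_triangles_le_sq M hC1 hd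
      exact h
    obtain ⟨R, hR⟩ := exists_isReps M
    have hRfin : R.Finite := M.ground_finite.subset hR.subset
    set Rf := hRfin.toFinset with hRf
    set a : α → ℕ := fun r => (M✶.closure {r}).ncard with ha
    have hRc : R.ncard = Rf.card := Set.ncard_eq_toFinset_card _ _
    have h1 : ∀ r ∈ Rf, 1 ≤ a r := by
      intro r hr
      rw [hRf, Set.Finite.mem_toFinset] at hr
      have hfin := cls_finite (M := M) r
      exact Nat.one_le_iff_ne_zero.2 (fun h0 => by
        have := (Set.ncard_eq_zero hfin).1 h0
        exact (Set.eq_empty_iff_forall_notMem.1 this r) (mem_cls_self hR hr))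
    have h4 : ∀ r ∈ Rf, a r ≤ 4 := by
      intro r hr
      rw [hRf, Set.Finite.mem_toFinset] at hr
      have hrE : r ∈ ⋃₀ PercRepro.Matroid.circuitsLE M 4 := by rw [← hS₀def, hS₀]; exact hR.subset hr
      obtain ⟨C, hC, hrC⟩ := Set.mem_sUnion.1 hrE
      have hsub := closure_dual_singleton_subset_of_mem_isCircuit hcoloop hC.1 hrC
      have hCfin : C.Finite := M.ground_finite.subset hC.1.subset_ground
      have hC4 : C.ncard ≤ 4 := by
        have := hC.2
        rw [← hCfin.cast_ncard_eq] at this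
        exact_mod_cast this
      exact (Set.ncard_le_ncard hsub hCfin).trans hC4
    set σ := (Rf.filter (fun r => a r = 1)).card with hσ
    set t₂ := (Rf.filter (fun r => a r = 2)).card with ht₂
    set t₃ := (Rf.filter (fun r => a r = 3)).card with ht₃
    set t₄ := (Rf.filter (fun r => a r = 4)).card with ht₄
    have hn : 9 + 7 = σ + 2 * t₂ + 3 * t₃ + 4 * t₄ := by
      rw [← hE, ncard_ground_eq_sum hcoloop hR hRfin, ← hRf]
      exact sum_eq_of_le_four Rf a h1 h4
    have hc : Rf.card = σ + t₂ + t₃ + t₄ := card_eq_of_le_four Rf a h1 h4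
    have hlm3 : (PercRepro.Matroid.circuitsEq M 3).ncard ≤ lm7 (σ + t₂ + t₃ + t₄) 3 := by
      have h := PercRepro.Matroid.ncard_isCircuit_mul_choose_le M hR.subset hR.nonloop hR.cover hR.inj hν 3
      rw [hRc, hc] at h
      exact le_lm7_of_mul_le h
    have hlm4 : (PercRepro.Matroid.circuitsEq M 4).ncard ≤ lm7 (σ + t₂ + t₃ + t₄) 4 := by
      have h := PercRepro.Matroid.ncard_isCircuit_mul_choose_le M hR.subset hR.nonloop hR.cover hR.inj hν 4
      rw [hRc, hc] at h
      exact le_lm7_of_mul_le h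
    have hw3 : (PercRepro.Matroid.circuitsEq M 3).ncard ≤ σ.choose 3 + σ * t₂ + t₃ :=
      (ncard_circuitsEq_le_card_weight hcoloop hR hRfin 3).trans (card_weight_three_le Rf a h1)
    have hw4 : (PercRepro.Matroid.circuitsEq M 4).ncard ≤
        σ.choose 4 + σ.choose 2 * t₂ + t₂.choose 2 + σ * t₃ + t₄ :=
      (ncard_circuitsEq_le_card_weight hcoloop hR hRfin 4).trans (card_weight_four_le Rf a h1)
    have hs₃ : (PercRepro.Matroid.circuitsEq M 3).ncard ≤ bound3seven σ t₂ t₃ t₄ :=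
      le_min hs49 (le_min hlm3 hw3)
    have hs₄ : (PercRepro.Matroid.circuitsEq M 4).ncard ≤ bound4seven σ t₂ t₃ t₄ := le_min hlm4 hw4
    exact rls_of_cellOK7 M 9 rfl hs hC1 hC2 hcoloop hrank hE hs₃ hs₄
      (table_dense7_16 σ (by omega) t₂ (by omega) t₃ (by omega) t₄ (by omega) hn.symm)

/-- **The small core cells without the corank-`4`, `5`, `6`, `7` cells closed by p2**: `p ∈ {7, 8}`, or `9 ≤ p ≤ 169`
with `p + 4 ≤ |E| < p + amin p` and corank `4` only at `18 ≤ p ≤ 95`, corank `5` only at `14 ≤ p`, no corank `6`, `7`. -/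
def SmallCoreCellsNine : Prop :=
  ∀ {α : Type} (M : Matroid α) [M.Finite] (p : ℕ), 5 ≤ p →
    (∀ e ∈ M.E, ∀ f ∈ M.E, e ≠ f → M.eRk {e, f} = 2) → M.eRank = (p : ℕ∞) →
    (∀ e, ¬ M.IsColoop e) →
    (∀ e ∈ M.E, ∃ A ⊆ M.E \ {e}, e ∉ M.closure A ∧ e ∉ M.closure ((M.E \ {e}) \ A)) →
    ((p = 7 ∨ p = 8) ∨
      (p ≤ 169 ∧ p + 4 ≤ M.E.ncard ∧ M.E.ncard < p + CoreRegimes.amin p ∧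
        ¬ (M.E.ncard = p + 4 ∧ 100 ≤ M.E.ncard) ∧ ¬ (M.E.ncard = p + 4 ∧ 9 ≤ p ∧ p ≤ 17) ∧
        ¬ (M.E.ncard = p + 5 ∧ 9 ≤ p ∧ p ≤ 13) ∧ ¬ (M.E.ncard = p + 6 ∧ 9 ≤ p ∧ p ≤ 12) ∧
        ¬ (M.E.ncard = p + 7 ∧ p = 9))) →
    ThmN.RLS M p 3

/-- `SmallCoreCellsNine` implies `SmallCoreCellsEight`: the `(9, 7)` cell is `c025_core_seven_nine`. -/
theorem smallCoreCellsEight_of_nine (h : SmallCoreCellsNine) : SmallCoreCellsEight := by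
  intro α M _ p hp hs hrank hcoloop hfree hcell
  rcases hcell with h78 | ⟨hp169, hlo, hhi, h100, h4, h5, h6⟩
  · exact h M p hp hs hrank hcoloop hfree (Or.inl h78)
  · by_cases h9 : M.E.ncard = p + 7 ∧ p = 9
    · obtain ⟨hE, rfl⟩ := h9
      exact c025_core_seven_nine M hs hcoloop hfree hrank hE
    · exact h M p hp hs hrank hcoloop hfree (Or.inr ⟨hp169, hlo, hhi, h100, h4, h5, h6, h9⟩)

/-- **C-025 at `q = 3` for every finite matroid and every `p ≥ 5`, from the cells of `SmallCoreCellsNine`.** -/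
theorem c025_three_of_smallCoreCellsNine (h : SmallCoreCellsNine) :
    ∀ {α : Type} (M : Matroid α) [M.Finite] (p : ℕ), 5 ≤ p → ThmN.RLS M p 3 :=
  c025_three_of_smallCoreCellsEight (smallCoreCellsEight_of_nine h)

end CoreFour
end PercRepro
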